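import Literature.NumberTheory.GaloisRepresentations.NeukirchUchidaKummerPackage
import Literature.NumberTheory.GaloisRepresentations.AbsGaloisGroup
import Mathlib.FieldTheory.Galois.Basic
import Mathlib.FieldTheory.Normal.Closure
import Mathlib.GroupTheory.Commutator.Basic
import Mathlib.GroupTheory.Index
import HarnessLib

/-!
# Neukirch–Uchida, Kummer package (K1): the Kummer field `M = N((gβ)^{1/ℓ} : g)` inside `\bar F`

Topic `NumberTheory/GaloisRepresentations`; namespace
`Literature.NumberTheory.GaloisRepresentations.NeukirchUchidaProof`.  PROOF-ONLY companion of
`NeukirchUchidaKummerPackage.lean` (theorems only; inputs: that file, the tree's `AbsGaloisGroup`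
action of `Γ = Field.absoluteGaloisGroup F` on `Ω = AlgebraicClosure F`, and Mathlib).  Written for
the abc-iut cell's GAP-LEDGER row G-L4d2g4-1, sub-DAG `plan/L4/SUBDAG-NeukirchUchida.md` row R8, in the
Γ-level currency of its §INTERFACES v2: number fields are `N : IntermediateField F Ω` (`F = ℚ` for the
sub-DAG), `Γ_K := K.fixingSubgroup.comap (absoluteGaloisGroup.toAlgEquiv F).toMonoidHom ≤ Γ`, and the
Kummer field is the CHOICE-FREE
`M := N ⊔ F⟮{y | ∃ c ∈ Γ • β, y ^ ℓ = c}⟯` (all `ℓ`-th roots of all conjugates of `β`).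
Normality of `N` enters only as Γ-stability `∀ σ : Γ, ∀ y ∈ N, σ • y ∈ N` (instance-free;
`forall_smul_mem_of_normal` derives it from `[Normal F N]`).

* `orbit_absoluteGaloisGroup_finite`, `rootSetOfOrbit_finite`, `smul_mem_rootSetOfOrbit` — the
  root set is finite and Γ-stable;
* (K1) `finiteDimensional_sup_adjoin_rootSetOfOrbit`, `normal_sup_adjoin_rootSetOfOrbit`,
  `isGalois_sup_adjoin_rootSetOfOrbit` (perfect base field) and the `F = ℚ` forms
  `finiteDimensional_rat_sup_adjoin_rootSetOfOrbit`, `isGalois_rat_sup_adjoin_rootSetOfOrbit`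
  (stated with the instances Lean synthesises at `ℚ`; the `ℚ`-algebra structure on a field is unique);
* (K1) **`comap_fixingSubgroup_sup_adjoin_rootSetOfOrbit`**: for chosen roots `x c` (`(x c)^ℓ = c` on
  the orbit) and `ζ_ℓ ∈ N`: `Γ_M = Γ_N ⊓ ⨅_{c ∈ Γ•β} Stab_Γ(x c)`;
* (K2) **`commutator_le_comap_fixingSubgroup_sup_adjoin_rootSetOfOrbit`**: `⁅Γ_N, Γ_N⁆ ≤ Γ_M`
  (`M/N` is a Kummer = abelian extension);
* (K2) **`relIndex_comap_fixingSubgroup_dvd`**: for `c` in the orbit and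
  `C_c := Γ_N ⊓ ⨅_{c' ∈ Γ•β ∖ {c}} Stab(x c')`, `[C_c : Γ_M ∩ C_c] ∣ ℓ` — the Kummer character
  `σ ↦ σ(x_c)/x_c` on `C_c` is a homomorphism into `μ_ℓ` with kernel `Γ_M`.

Classical Kummer theory (Neukirch, *Algebraic Number Theory* IV §3, Prop. (3.6): for `μ_n ⊆ K`,
`K(Δ^{1/n})/K` is abelian of exponent `n` with `Gal ≅ Hom(Δ K^{×n}/K^{×n}, μ_n)`).  HONEST FRAMING:
classical (our kernel check); nothing here bears on [IUTchIII] Cor. 3.12.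

## References
* J. Neukirch, *Algebraic Number Theory* (1999), Ch. IV §3 Prop. (3.6) (Kummer theory). [NeukirchANT1999]
* J. Neukirch, A. Schmidt, K. Wingberg, *Cohomology of Number Fields* (2008), (12.2.1). [NeukirchSchmidtWingberg2008]
-/

open scoped Pointwise commutatorElement
open Polynomial Field IntermediateField

namespace Literature.NumberTheory.GaloisRepresentations.NeukirchUchidaProof

section KummerField

variable {F : Type*} [Field F] {ℓ : ℕ} {β : AlgebraicClosure F}

/-- **The Galois orbit of an algebraic element is finite** (it consists of roots of the minimal
polynomial). [cite: NeukirchANT1999, Ch. IV §3 Prop. (3.6)] -/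
theorem orbit_absoluteGaloisGroup_finite (β : AlgebraicClosure F) :
    (MulAction.orbit (absoluteGaloisGroup F) β).Finite := by
  refine ((minpoly F β).rootSet_finite (AlgebraicClosure F)).subset ?_
  rintro _ ⟨σ, rfl⟩
  have hint : IsIntegral F β := (Algebra.IsAlgebraic.isAlgebraic (R := F) β).isIntegral
  rw [Polynomial.mem_rootSet_of_ne (minpoly.ne_zero hint)]
  change Polynomial.aeval ((absoluteGaloisGroup.toAlgEquiv F σ) β) (minpoly F β) = 0
  rw [Polynomial.aeval_algHom_apply, minpoly.aeval, map_zero]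

/-- The set `{y | ∃ c ∈ Γ•β, y^ℓ = c}` of all `ℓ`-th roots of all conjugates of `β` is finite (`ℓ > 0`).
[cite: NeukirchANT1999, Ch. IV §3 Prop. (3.6)] -/
theorem rootSetOfOrbit_finite (hℓ : 0 < ℓ) (β : AlgebraicClosure F) :
    {y : AlgebraicClosure F | ∃ c ∈ MulAction.orbit (absoluteGaloisGroup F) β, y ^ ℓ = c}.Finite := by
  classical
  refine ((orbit_absoluteGaloisGroup_finite β).biUnion
    (t := fun c => {y : AlgebraicClosure F | y ^ ℓ = c}) fun c _ => ?_).subset ?_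
  · refine ((Polynomial.nthRoots ℓ c).toFinset.finite_toSet).subset fun y hy => ?_
    simp only [Set.mem_setOf_eq] at hy
    simp [Polynomial.mem_nthRoots hℓ, hy]
  · rintro y ⟨c, hc, hyc⟩
    exact Set.mem_biUnion hc hyc

/-- The set of all `ℓ`-th roots of all conjugates of `β` is stable under `Γ = Gal(\bar F/F)`.
[cite: NeukirchANT1999, Ch. IV §3 Prop. (3.6)] -/
theorem smul_mem_rootSetOfOrbit (σ : absoluteGaloisGroup F) {y : AlgebraicClosure F}
    (hy : y ∈ {y : AlgebraicClosure F | ∃ c ∈ MulAction.orbit (absoluteGaloisGroup F) β, y ^ ℓ = c}) :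
    σ • y ∈ {y : AlgebraicClosure F | ∃ c ∈ MulAction.orbit (absoluteGaloisGroup F) β, y ^ ℓ = c} := by
  obtain ⟨c, ⟨τ, rfl⟩, hyc⟩ := hy
  exact ⟨σ • τ • β, ⟨σ * τ, mul_smul σ τ β⟩, by rw [← smul_pow', hyc]⟩

/-- **(K1) `M = N ⊔ F⟮roots⟯` is finite over `F`** when `N` is (finitely many algebraic generators).
[cite: NeukirchANT1999, Ch. IV §3 Prop. (3.6)] -/
theorem finiteDimensional_sup_adjoin_rootSetOfOrbit (N : IntermediateField F (AlgebraicClosure F))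
    [FiniteDimensional F N] (hℓ : 0 < ℓ) (β : AlgebraicClosure F) :
    FiniteDimensional F ↥(N ⊔ IntermediateField.adjoin F
      {y : AlgebraicClosure F | ∃ c ∈ MulAction.orbit (absoluteGaloisGroup F) β, y ^ ℓ = c}) := by
  haveI : Finite {y : AlgebraicClosure F | ∃ c ∈ MulAction.orbit (absoluteGaloisGroup F) β, y ^ ℓ = c} :=
    (rootSetOfOrbit_finite hℓ β).to_subtype
  haveI : FiniteDimensional F (IntermediateField.adjoin F
      {y : AlgebraicClosure F | ∃ c ∈ MulAction.orbit (absoluteGaloisGroup F) β, y ^ ℓ = c}) :=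
    IntermediateField.finiteDimensional_adjoin fun y _ =>
      (Algebra.IsAlgebraic.isAlgebraic (R := F) y).isIntegral
  infer_instance

/-- **(K1) `M = N ⊔ F⟮roots⟯` is normal over `F`** when `N` is Γ-stable: `σ(M) ⊆ M` for every
`σ ∈ Aut(\bar F/F)` since the generating set is Γ-stable (Mathlib
`IntermediateField.normal_iff_forall_map_le'`). [cite: NeukirchANT1999, Ch. IV §3 Prop. (3.6)] -/
theorem normal_sup_adjoin_rootSetOfOrbit (N : IntermediateField F (AlgebraicClosure F))
    (hN : ∀ σ : absoluteGaloisGroup F, ∀ y ∈ N, σ • y ∈ N) (β : AlgebraicClosure F) (ℓ : ℕ) :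
    Normal F ↥(N ⊔ IntermediateField.adjoin F
      {y : AlgebraicClosure F | ∃ c ∈ MulAction.orbit (absoluteGaloisGroup F) β, y ^ ℓ = c}) := by
  rw [IntermediateField.normal_iff_forall_map_le']
  intro σ
  rw [IntermediateField.map_sup]
  have hNσ : N.map (σ : AlgebraicClosure F →ₐ[F] AlgebraicClosure F) ≤ N := by
    rintro _ ⟨y, hy, rfl⟩
    exact hN ((absoluteGaloisGroup.toAlgEquiv F).symm σ) y hy
  refine sup_le_sup hNσ ?_
  rw [IntermediateField.adjoin_map]
  refine IntermediateField.adjoin.mono _ _ _ ?_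
  rintro _ ⟨y, hy, rfl⟩
  exact smul_mem_rootSetOfOrbit ((absoluteGaloisGroup.toAlgEquiv F).symm σ) hy

/-- **(K1) `M` is Galois over a perfect base field `F`** (normal + separable).
[cite: NeukirchANT1999, Ch. IV §3 Prop. (3.6)] -/
theorem isGalois_sup_adjoin_rootSetOfOrbit [PerfectField F]
    (N : IntermediateField F (AlgebraicClosure F))
    (hN : ∀ σ : absoluteGaloisGroup F, ∀ y ∈ N, σ • y ∈ N) (β : AlgebraicClosure F) (ℓ : ℕ) :
    IsGalois F ↥(N ⊔ IntermediateField.adjoin F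
      {y : AlgebraicClosure F | ∃ c ∈ MulAction.orbit (absoluteGaloisGroup F) β, y ^ ℓ = c}) := by
  haveI := normal_sup_adjoin_rootSetOfOrbit N hN β ℓ
  exact IsGalois.mk

/-- A normal intermediate field `N` of `\bar F/F` is Γ-stable: `σ • y ∈ N` for `y ∈ N`, `σ ∈ Γ`.
[cite: NeukirchANT1999, Ch. IV §1] -/
theorem forall_smul_mem_of_normal (N : IntermediateField F (AlgebraicClosure F)) [Normal F N]
    (σ : absoluteGaloisGroup F) {y : AlgebraicClosure F} (hy : y ∈ N) : σ • y ∈ N :=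
  (IntermediateField.normal_iff_forall_map_le'.mp inferInstance (absoluteGaloisGroup.toAlgEquiv F σ))
    ⟨y, hy, rfl⟩

end KummerField

/-! ### Fixing subgroups: `Γ_M = Γ_N ∩ ⋂_c Stab(x_c)` and the Kummer characters on `Γ_N` -/

section FixingSubgroups

variable {F : Type*} [Field F] {ℓ : ℕ} {ζ β : AlgebraicClosure F}

/-- Membership in `Γ_K = K.fixingSubgroup` pulled back to `Γ = Field.absoluteGaloisGroup F`:
`σ ∈ Γ_K ↔ σ` fixes `K` pointwise. [cite: NeukirchANT1999, Ch. IV §1] -/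
theorem mem_comap_fixingSubgroup_iff (K : IntermediateField F (AlgebraicClosure F))
    (σ : absoluteGaloisGroup F) :
    σ ∈ K.fixingSubgroup.comap (absoluteGaloisGroup.toAlgEquiv F).toMonoidHom ↔
      ∀ y ∈ K, σ • y = y := by
  rw [Subgroup.mem_comap, MulEquiv.coe_toMonoidHom, IntermediateField.mem_fixingSubgroup_iff]
  rfl

/-- The conjugates of `β ∈ N` lie in the Γ-stable field `N`. [cite: NeukirchANT1999, Ch. IV §1] -/
theorem mem_of_mem_orbit (N : IntermediateField F (AlgebraicClosure F))
    (hN : ∀ σ : absoluteGaloisGroup F, ∀ y ∈ N, σ • y ∈ N) (hβN : β ∈ N)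
    {c : AlgebraicClosure F} (hc : c ∈ MulAction.orbit (absoluteGaloisGroup F) β) : c ∈ N := by
  obtain ⟨σ, rfl⟩ := hc
  exact hN σ β hβN

/-- Elements of `Γ_N` fix every conjugate of `β ∈ N` (`N` Γ-stable). [cite: NeukirchANT1999, Ch. IV §1] -/
theorem smul_eq_self_of_mem_orbit (N : IntermediateField F (AlgebraicClosure F))
    (hN : ∀ σ : absoluteGaloisGroup F, ∀ y ∈ N, σ • y ∈ N) (hβN : β ∈ N) {σ : absoluteGaloisGroup F}
    (hσ : σ ∈ N.fixingSubgroup.comap (absoluteGaloisGroup.toAlgEquiv F).toMonoidHom)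
    {c : AlgebraicClosure F} (hc : c ∈ MulAction.orbit (absoluteGaloisGroup F) β) : σ • c = c :=
  (mem_comap_fixingSubgroup_iff N σ).mp hσ c (mem_of_mem_orbit N hN hβN hc)

/-- Every `ℓ`-th root of a conjugate `c` is `ζ^i · x_c` for the chosen root `x_c`, hence is fixed by
any `σ` fixing `ζ` and all the `x_c`. [cite: NeukirchANT1999, Ch. IV §3 Prop. (3.6)] -/
theorem smul_eq_self_of_mem_rootSetOfOrbit (hℓ : ℓ.Prime) (hζ : IsPrimitiveRoot ζ ℓ)
    (x : AlgebraicClosure F → AlgebraicClosure F)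
    (hx : ∀ c ∈ MulAction.orbit (absoluteGaloisGroup F) β, x c ^ ℓ = c)
    {σ : absoluteGaloisGroup F} (hσζ : σ • ζ = ζ)
    (hσx : ∀ c ∈ MulAction.orbit (absoluteGaloisGroup F) β, σ • x c = x c) {y : AlgebraicClosure F}
    (hy : y ∈ {y : AlgebraicClosure F | ∃ c ∈ MulAction.orbit (absoluteGaloisGroup F) β, y ^ ℓ = c}) :
    σ • y = y := by
  obtain ⟨c, hc, hyc⟩ := hy
  obtain ⟨i, -, hi⟩ := exists_eq_pow_mul_of_pow_eq_pow hℓ hζ (hyc.trans (hx c hc).symm)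
  rw [hi, smul_mul', smul_pow', hσζ, hσx c hc]

/-- **(K1) The fixing subgroup of the Kummer field**: if `ζ_ℓ ∈ N` and `x c` is a chosen `ℓ`-th root
of each conjugate `c ∈ Γ•β`, then `Γ_M = Γ_N ⊓ ⨅_{c ∈ Γ•β} Stab_Γ(x c)` for
`M = N ⊔ F⟮all ℓ-th roots of all conjugates⟯` — an automorphism fixing `N` and the `x_c` fixes
every root `ζ^i x_c`, hence `M`. [cite: NeukirchANT1999, Ch. IV §3 Prop. (3.6)] -/
theorem comap_fixingSubgroup_sup_adjoin_rootSetOfOrbit (hℓ : ℓ.Prime) (hζ : IsPrimitiveRoot ζ ℓ)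
    (N : IntermediateField F (AlgebraicClosure F)) (hζN : ζ ∈ N) (β : AlgebraicClosure F)
    (x : AlgebraicClosure F → AlgebraicClosure F)
    (hx : ∀ c ∈ MulAction.orbit (absoluteGaloisGroup F) β, x c ^ ℓ = c) :
    (N ⊔ IntermediateField.adjoin F
        {y : AlgebraicClosure F | ∃ c ∈ MulAction.orbit (absoluteGaloisGroup F) β, y ^ ℓ = c}).fixingSubgroup.comap
        (absoluteGaloisGroup.toAlgEquiv F).toMonoidHom =
      N.fixingSubgroup.comap (absoluteGaloisGroup.toAlgEquiv F).toMonoidHom ⊓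
        ⨅ c ∈ MulAction.orbit (absoluteGaloisGroup F) β, MulAction.stabilizer (absoluteGaloisGroup F) (x c) := by
  set S := {y : AlgebraicClosure F | ∃ c ∈ MulAction.orbit (absoluteGaloisGroup F) β, y ^ ℓ = c} with hS
  ext σ
  simp only [Subgroup.mem_inf, Subgroup.mem_iInf, MulAction.mem_stabilizer_iff,
    mem_comap_fixingSubgroup_iff]
  constructor
  · intro h
    refine ⟨fun y hy => h y (le_sup_left (b := IntermediateField.adjoin F S) hy),
      fun c hc => h (x c) ?_⟩
    exact le_sup_right (a := N) (IntermediateField.subset_adjoin F S ⟨c, hc, hx c hc⟩)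
  · rintro ⟨hN, hxc⟩
    have hσζ : σ • ζ = ζ := hN ζ hζN
    have hσS : ∀ y ∈ S, σ • y = y := fun y hy =>
      smul_eq_self_of_mem_rootSetOfOrbit hℓ hζ x hx hσζ hxc hy
    -- `σ` fixes `N ⊔ F(S)` because it fixes `N` and `S`
    have hS' : (absoluteGaloisGroup.toAlgEquiv F σ) ∈ (IntermediateField.adjoin F S).fixingSubgroup := by
      rw [IntermediateField.mem_fixingSubgroup_iff]
      intro y hy
      induction hy using IntermediateField.adjoin_induction with
      | mem y hy => exact hσS y hy
      | algebraMap c => exact AlgEquiv.commutes _ c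
      | add y z _ _ hy hz => rw [map_add, hy, hz]
      | inv y _ hy => rw [map_inv₀, hy]
      | mul y z _ _ hy hz => rw [map_mul, hy, hz]
    have h1 : (absoluteGaloisGroup.toAlgEquiv F σ) ∈
        (N ⊔ IntermediateField.adjoin F S).fixingSubgroup := by
      rw [IntermediateField.fixingSubgroup_sup]
      exact ⟨(IntermediateField.mem_fixingSubgroup_iff _ _).mpr hN, hS'⟩
    exact fun y hy => (IntermediateField.mem_fixingSubgroup_iff _ _).mp h1 y hy

/-- If `σ • x = a x` with `σ a = a ≠ 0` then `σ⁻¹ • x = a⁻¹ x`. [cite: NeukirchANT1999, Ch. IV §3 Prop. (3.6)] -/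
theorem inv_smul_eq_inv_mul {G : Type*} [Group G] {Ω : Type*} [Field Ω] [MulSemiringAction G Ω]
    {σ : G} {a x : Ω} (ha : a ≠ 0) (hσa : σ • a = a) (hσx : σ • x = a * x) :
    σ⁻¹ • x = a⁻¹ * x := by
  have hσa' : σ⁻¹ • a = a := by
    conv_lhs => rw [← hσa]
    rw [inv_smul_smul]
  have h : x = a * (σ⁻¹ • x) := by
    conv_lhs => rw [← inv_smul_smul σ x, hσx, smul_mul', hσa']
  rw [eq_inv_mul_iff_mul_eq₀ ha, ← h]

/-- A commutator `⁅σ, τ⁆` acts trivially on a common «eigenvector» `x` (`σ • x = a x`, `τ • x = b x`)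
whose «eigenvalues» `a, b ≠ 0` are fixed by `σ` and `τ` — the computation behind «Kummer extensions
are abelian». [cite: NeukirchANT1999, Ch. IV §3 Prop. (3.6)] -/
theorem commutatorElement_smul_eq_self {G : Type*} [Group G] {Ω : Type*} [Field Ω]
    [MulSemiringAction G Ω] {σ τ : G} {a b x : Ω} (ha : a ≠ 0) (hb : b ≠ 0)
    (hσa : σ • a = a) (hσb : σ • b = b) (hτa : τ • a = a) (hτb : τ • b = b)
    (hσx : σ • x = a * x) (hτx : τ • x = b * x) : ⁅σ, τ⁆ • x = x := by
  have hσb' : σ⁻¹ • b = b := by conv_lhs => rw [← hσb]; rw [inv_smul_smul]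
  have h1 : τ⁻¹ • x = b⁻¹ * x := inv_smul_eq_inv_mul hb hτb hτx
  have h2 : σ⁻¹ • (b⁻¹ * x) = b⁻¹ * (a⁻¹ * x) := by
    rw [smul_mul', smul_inv'', hσb', inv_smul_eq_inv_mul ha hσa hσx]
  have h3 : τ • (b⁻¹ * (a⁻¹ * x)) = b⁻¹ * (a⁻¹ * (b * x)) := by
    rw [smul_mul', smul_inv'', hτb, smul_mul', smul_inv'', hτa, hτx]
  have h4 : σ • (b⁻¹ * (a⁻¹ * (b * x))) = b⁻¹ * (a⁻¹ * (b * (a * x))) := by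
    rw [smul_mul', smul_inv'', hσb, smul_mul', smul_inv'', hσa, smul_mul', hσb, hσx]
  rw [commutatorElement_def, mul_smul, mul_smul, mul_smul, h1, h2, h3, h4]
  field_simp

/-- **(K2) `⁅Γ_N, Γ_N⁆ ≤ Γ_M`**: the Kummer field `M = N ⊔ F⟮(Γ•β)^{1/ℓ}⟯` (`ζ_ℓ, β ∈ N`, `N`
Γ-stable) is abelian over `N`, so every subgroup between `Γ_M` and `Γ_N` is normal in `Γ_N`.
[cite: NeukirchANT1999, Ch. IV §3 Prop. (3.6)] -/
theorem commutator_le_comap_fixingSubgroup_sup_adjoin_rootSetOfOrbit (hℓ : ℓ.Prime)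
    (hζ : IsPrimitiveRoot ζ ℓ) (N : IntermediateField F (AlgebraicClosure F))
    (hN : ∀ σ : absoluteGaloisGroup F, ∀ y ∈ N, σ • y ∈ N) (hζN : ζ ∈ N) (hβN : β ∈ N) :
    ⁅N.fixingSubgroup.comap (absoluteGaloisGroup.toAlgEquiv F).toMonoidHom,
      N.fixingSubgroup.comap (absoluteGaloisGroup.toAlgEquiv F).toMonoidHom⁆ ≤
      (N ⊔ IntermediateField.adjoin F
        {y : AlgebraicClosure F | ∃ c ∈ MulAction.orbit (absoluteGaloisGroup F) β, y ^ ℓ = c}).fixingSubgroup.comap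
        (absoluteGaloisGroup.toAlgEquiv F).toMonoidHom := by
  classical
  -- choose `ℓ`-th roots of everything (any choice of `x_c` will do)
  have hroot : ∀ c : AlgebraicClosure F, ∃ x : AlgebraicClosure F, x ^ ℓ = c := fun c =>
    IsAlgClosed.exists_pow_nat_eq c hℓ.pos
  choose x hx using hroot
  rw [comap_fixingSubgroup_sup_adjoin_rootSetOfOrbit hℓ hζ N hζN β x (fun c _ => hx c),
    Subgroup.commutator_le]
  intro σ hσ τ hτ
  refine Subgroup.mem_inf.mpr ⟨?_, ?_⟩
  · rw [commutatorElement_def]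
    exact Subgroup.mul_mem _ (Subgroup.mul_mem _ (Subgroup.mul_mem _ hσ hτ) (Subgroup.inv_mem _ hσ))
      (Subgroup.inv_mem _ hτ)
  · refine Subgroup.mem_iInf.mpr fun c => Subgroup.mem_iInf.mpr fun hc => ?_
    rw [MulAction.mem_stabilizer_iff]
    have hσc : σ • c = c := smul_eq_self_of_mem_orbit N hN hβN hσ hc
    have hτc : τ • c = c := smul_eq_self_of_mem_orbit N hN hβN hτ hc
    obtain ⟨i, -, hi⟩ := exists_smul_eq_pow_mul hℓ hζ (hx c) hσc
    obtain ⟨j, -, hj⟩ := exists_smul_eq_pow_mul hℓ hζ (hx c) hτc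
    have hζ0 : ζ ≠ 0 := hζ.ne_zero hℓ.ne_zero
    have hσζ : σ • ζ = ζ := (mem_comap_fixingSubgroup_iff N σ).mp hσ ζ hζN
    have hτζ : τ • ζ = ζ := (mem_comap_fixingSubgroup_iff N τ).mp hτ ζ hζN
    exact commutatorElement_smul_eq_self (pow_ne_zero i hζ0) (pow_ne_zero j hζ0)
      (by rw [smul_pow', hσζ]) (by rw [smul_pow', hσζ]) (by rw [smul_pow', hτζ])
      (by rw [smul_pow', hτζ]) hi hj

/-- **(K2) The Kummer character at one conjugate**: for `c ∈ Γ•β` (`β ≠ 0`, `ζ_ℓ, β ∈ N`, `N`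
Γ-stable) and `C_c := Γ_N ⊓ ⨅_{c' ∈ Γ•β ∖ {c}} Stab_Γ(x c')`, the map `σ ↦ σ(x_c)/x_c` on `C_c` is a
homomorphism into `μ_ℓ(\bar F)` with kernel `Γ_M ∩ C_c`; hence `[C_c : Γ_M ∩ C_c] ∣ ℓ`
(`Subgroup.relIndex`). [cite: NeukirchANT1999, Ch. IV §3 Prop. (3.6)] -/
theorem relIndex_comap_fixingSubgroup_dvd (hℓ : ℓ.Prime) (hζ : IsPrimitiveRoot ζ ℓ)
    (N : IntermediateField F (AlgebraicClosure F))
    (hN : ∀ σ : absoluteGaloisGroup F, ∀ y ∈ N, σ • y ∈ N) (hζN : ζ ∈ N) (hβN : β ∈ N)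
    (hβ0 : β ≠ 0) (x : AlgebraicClosure F → AlgebraicClosure F)
    (hx : ∀ c ∈ MulAction.orbit (absoluteGaloisGroup F) β, x c ^ ℓ = c)
    {c : AlgebraicClosure F} (hc : c ∈ MulAction.orbit (absoluteGaloisGroup F) β) :
    Subgroup.relIndex
      ((N ⊔ IntermediateField.adjoin F
        {y : AlgebraicClosure F | ∃ c ∈ MulAction.orbit (absoluteGaloisGroup F) β, y ^ ℓ = c}).fixingSubgroup.comap
        (absoluteGaloisGroup.toAlgEquiv F).toMonoidHom)
      (N.fixingSubgroup.comap (absoluteGaloisGroup.toAlgEquiv F).toMonoidHom ⊓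
        ⨅ c' ∈ MulAction.orbit (absoluteGaloisGroup F) β \ {c},
          MulAction.stabilizer (absoluteGaloisGroup F) (x c')) ∣ ℓ := by
  classical
  haveI : NeZero ℓ := ⟨hℓ.ne_zero⟩
  set Γ := absoluteGaloisGroup F
  set ΓN := N.fixingSubgroup.comap (absoluteGaloisGroup.toAlgEquiv F).toMonoidHom with hΓN
  set C := ΓN ⊓ ⨅ c' ∈ MulAction.orbit Γ β \ {c}, MulAction.stabilizer Γ (x c') with hC
  rw [comap_fixingSubgroup_sup_adjoin_rootSetOfOrbit hℓ hζ N hζN β x hx]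
  -- `x c ≠ 0`
  have hc0 : c ≠ 0 := by
    obtain ⟨g, rfl⟩ := hc
    intro h
    exact hβ0 (by simpa using congrArg (fun z => g⁻¹ • z) h)
  have hxc0 : x c ≠ 0 := fun h => hc0 (by rw [← hx c hc, h, zero_pow hℓ.ne_zero])
  have hζ0 : ζ ≠ 0 := hζ.ne_zero hℓ.ne_zero
  -- members of `C` fix `ζ` and `c`, and act on `x c` by an `ℓ`-th root of unity
  have hCN : ∀ σ : C, (σ : Γ) ∈ ΓN := fun σ => (Subgroup.mem_inf.mp σ.2).1
  have hCζ : ∀ σ : C, (σ : Γ) • ζ = ζ := fun σ =>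
    (mem_comap_fixingSubgroup_iff N _).mp (hCN σ) ζ hζN
  have hCc : ∀ σ : C, (σ : Γ) • c = c := fun σ => smul_eq_self_of_mem_orbit N hN hβN (hCN σ) hc
  -- the Kummer character `f σ = σ • x_c / x_c` as a homomorphism into the units
  have hval : ∀ σ : C, (σ : Γ) • x c / x c ≠ 0 := fun σ => by
    obtain ⟨i, -, hi⟩ := exists_smul_eq_pow_mul hℓ hζ (hx c hc) (hCc σ)
    rw [hi, mul_div_cancel_right₀ _ hxc0]
    exact pow_ne_zero i hζ0
  let f : C →* (AlgebraicClosure F)ˣ :=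
    { toFun := fun σ => Units.mk0 _ (hval σ)
      map_one' := by
        ext
        simp only [Units.val_mk0, OneMemClass.coe_one, one_smul, Units.val_one, div_self hxc0]
      map_mul' := fun σ τ => by
        ext
        simp only [Units.val_mk0, Units.val_mul, Subgroup.coe_mul]
        obtain ⟨j, -, hj⟩ := exists_smul_eq_pow_mul hℓ hζ (hx c hc) (hCc τ)
        rw [mul_smul, hj, smul_mul', smul_pow', hCζ σ]
        field_simp }
  -- its kernel is `Γ_M ∩ C`
  have hker : f.ker = (ΓN ⊓ ⨅ c' ∈ MulAction.orbit Γ β, MulAction.stabilizer Γ (x c')).subgroupOf C := by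
    ext σ
    rw [MonoidHom.mem_ker, Subgroup.mem_subgroupOf, Units.ext_iff]
    simp only [f, MonoidHom.coe_mk, OneHom.coe_mk, Units.val_mk0, Units.val_one,
      div_eq_one_iff_eq hxc0]
    constructor
    · intro h
      refine Subgroup.mem_inf.mpr ⟨hCN σ, Subgroup.mem_iInf.mpr fun c' => Subgroup.mem_iInf.mpr fun hc' => ?_⟩
      by_cases hcc : c' = c
      · subst hcc; exact h
      · exact Subgroup.mem_iInf.mp (Subgroup.mem_iInf.mp (Subgroup.mem_inf.mp σ.2).2 c') ⟨hc', hcc⟩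
    · intro h
      exact Subgroup.mem_iInf.mp (Subgroup.mem_iInf.mp (Subgroup.mem_inf.mp h).2 c) hc
  -- and its image lies in `μ_ℓ`
  have hrange : f.range ≤ rootsOfUnity ℓ (AlgebraicClosure F) := by
    rintro _ ⟨σ, rfl⟩
    rw [mem_rootsOfUnity', ]
    change ((σ : Γ) • x c / x c) ^ ℓ = 1
    rw [div_pow, ← smul_pow', hx c hc, hCc σ, div_self hc0]
  rw [Subgroup.relIndex, ← hker, Subgroup.index_ker, ← hζ.card_rootsOfUnity]
  exact Subgroup.card_dvd_of_le hrange

end FixingSubgroups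

/-! ### The case `F = ℚ` (the sub-DAG's currency `Ω = \bar ℚ`, `Γ = Gal(\bar ℚ/ℚ)`) -/

section Rat

/-- **(K1) at `F = ℚ`**: `M` is finite over `ℚ`, stated with the `ℚ`-module structure Lean
synthesises for a field of characteristic `0` (unique: `subsingleton_rat_module`).
[cite: NeukirchANT1999, Ch. IV §3 Prop. (3.6)] -/
theorem finiteDimensional_rat_sup_adjoin_rootSetOfOrbit (N : IntermediateField ℚ (AlgebraicClosure ℚ))
    [FiniteDimensional ℚ N] {ℓ : ℕ} (hℓ : 0 < ℓ) (β : AlgebraicClosure ℚ) :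
    FiniteDimensional ℚ ↥(N ⊔ IntermediateField.adjoin ℚ
      {y : AlgebraicClosure ℚ | ∃ c ∈ MulAction.orbit (absoluteGaloisGroup ℚ) β, y ^ ℓ = c}) := by
  have key : ∀ inst : Algebra ℚ ↥(N ⊔ IntermediateField.adjoin ℚ
      {y : AlgebraicClosure ℚ | ∃ c ∈ MulAction.orbit (absoluteGaloisGroup ℚ) β, y ^ ℓ = c}),
      @FiniteDimensional ℚ _ _ _ (@Algebra.toModule _ _ _ _ inst) := by
    intro inst
    obtain rfl : inst = IntermediateField.algebra' _ := Subsingleton.elim _ _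
    exact finiteDimensional_sup_adjoin_rootSetOfOrbit N hℓ β
  exact key _

/-- **(K1) at `F = ℚ`**: `M` is Galois over `ℚ` for a Γ-stable `N`, stated with the `ℚ`-algebra
structure Lean synthesises (unique: `algebra_rat_subsingleton`). [cite: NeukirchANT1999, Ch. IV §3 Prop. (3.6)] -/
theorem isGalois_rat_sup_adjoin_rootSetOfOrbit (N : IntermediateField ℚ (AlgebraicClosure ℚ))
    (hN : ∀ σ : absoluteGaloisGroup ℚ, ∀ y ∈ N, σ • y ∈ N) (β : AlgebraicClosure ℚ) (ℓ : ℕ) :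
    IsGalois ℚ ↥(N ⊔ IntermediateField.adjoin ℚ
      {y : AlgebraicClosure ℚ | ∃ c ∈ MulAction.orbit (absoluteGaloisGroup ℚ) β, y ^ ℓ = c}) := by
  have key : ∀ inst : Algebra ℚ ↥(N ⊔ IntermediateField.adjoin ℚ
      {y : AlgebraicClosure ℚ | ∃ c ∈ MulAction.orbit (absoluteGaloisGroup ℚ) β, y ^ ℓ = c}),
      @IsGalois ℚ _ _ _ inst := by
    intro inst
    obtain rfl : inst = IntermediateField.algebra' _ := Subsingleton.elim _ _
    exact isGalois_sup_adjoin_rootSetOfOrbit N hN β ℓ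
  exact key _

end Rat

end Literature.NumberTheory.GaloisRepresentations.NeukirchUchidaProof
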